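import Summits.ResolutionOfSingularities.ResolutionOfSingularities.Theorems.RadicialJungCleanResolvesRegularType
import Literature.AlgebraicGeometry.Resolution.RegularLocalRingsQuotient

/-!
# Route `RadicialJung`, crux `CleanModelsSuffice`, line `Sketch`: regular-type points carry a
# regular system of parameters adapted to the boundary

Registered stub `stub_regularTypeSop` of the skeleton of
`Summit.ResolutionOfSingularities.ResolutionOfSingularities.Theses.RadicialJung.CleanModelsSuffice`
(stmt-ResolutionOfSingularities-15883). At a point `v` of REGULAR TYPE of the clean regular model `V`
(the generator `y` of the purely inseparable degree-`p` extension `L/K(V)` has `y^p = u₀ ∈ O = 𝒪_{V,v}`,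
WOUND `∀ x, u₀ - x^p ∉ 𝔪` or TRANSVERSAL to the boundary `u₀ - x^p ∈ 𝔪 ∖ (𝔪² + (t_ι))`), the
local ring of the normalisation `V^L` over `v` is `C = integralClosure O L`, and the Kato chart there
is given by the boundary parameters `t_{ι 1}, …, t_{ι r}` (a sub-family of a regular system of
parameters `t₁, …, t_d` of `O`). Kato-regularity of that chart is: `C` is regular, `C/(t_ι)` is
regular, and `dim C/(t_ι) + r = dim C`. This file proves exactly that (`stub_regularTypeSop`).

Proof: `C ≅ B := O[T]/(T^p - u₀)` once `B` is regular
(`CleanResolves.isIntegralClosure_adjoinRoot_of_isRegularLocalRing` + `IsIntegralClosure.equiv`);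
`B` is regular by the wound / transversal exits of route `pAlteration`
(`PicoverLocalModel.WoundExit.isRegularLocalRing_adjoinRoot_of_wound`,
`PicoverLocalModel.TransversalExit.isRegularLocalRing_adjoinRoot_of_transversal`);
`B/(t_ι)B ≅ Ō[T]/(T^p - ū₀)` with `Ō = O/(t_ι)` (`AdjoinRoot.quotEquivQuotMap`), where `Ō` is a
regular local ring of dimension `d - r` (Matsumura 14.2, `quotient_isRegularLocalRing_tfae`) for
which `ū₀` is again wound, resp. transversal (`ū₀ - x̄^p ∈ 𝔪̄ ∖ 𝔪̄²` is the hypothesis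
`u₀ - x^p ∉ 𝔪² + (t_ι)`), so the same exits apply to `Ō`; dimensions are compared through the
finite injective extensions `O ⊆ B`, `Ō ⊆ B̄` (`ringKrullDim_eq_of_isIntegral`).
-/

noncomputable section

set_option linter.dupNamespace false -- mandated namespace of this single-conjunct summit

open Polynomial IsLocalRing
open Literature.AlgebraicGeometry.Resolution
open Summit.ResolutionOfSingularities.ResolutionOfSingularities.Theorems.PicoverLocalModel
open Summit.ResolutionOfSingularities.ResolutionOfSingularities.Theorems.RadicialJung.CleanResolves

namespace Summit.ResolutionOfSingularities.ResolutionOfSingularities.Theorems.RadicialJung.CleanModelsSuffice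

/-- **A sub-family of a regular system of parameters cuts out a regular local ring of the
complementary dimension** (Matsumura 14.2, (1) ⇒ (3)): if `(O, 𝔪)` is a regular local ring of
dimension `d`, `𝔪 = (t₁, …, t_d)`, and `ι : Fin r ↪ Fin d`, then `O/(t_{ι 1}, …, t_{ι r})` is a
regular local ring and `dim O/(t_ι) + r = dim O`. [cite: Matsumura1987, Thm. 14.2] -/
theorem isRegularLocalRing_quotient_span_range_comp {O : Type*} [CommRing O]
    [IsRegularLocalRing O] (d : ℕ) (t : Fin d → O)
    (htspan : Ideal.span (Set.range t) = maximalIdeal O)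
    (htdim : ringKrullDim O = (d : WithBot ℕ∞)) (r : ℕ) (ι : Fin r → Fin d)
    (hι : Function.Injective ι) :
    IsRegularLocalRing (O ⧸ Ideal.span (Set.range (t ∘ ι))) ∧
      ringKrullDim (O ⧸ Ideal.span (Set.range (t ∘ ι))) + (r : WithBot ℕ∞) = ringKrullDim O := by
  classical
  set S : Finset O := Finset.univ.image (t ∘ ι) with hS_def
  set T : Finset O := Finset.univ.image t with hT_def
  have hS : (S : Set O) = Set.range (t ∘ ι) := by
    rw [hS_def, Finset.coe_image, Finset.coe_univ, Set.image_univ]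
  have hT : (T : Set O) = Set.range t := by
    rw [hT_def, Finset.coe_image, Finset.coe_univ, Set.image_univ]
  -- `T` has exactly `d = emb dim O` elements, so `t` is injective
  have hTcard_le : T.card ≤ d :=
    Finset.card_image_le.trans (by rw [Finset.card_univ, Fintype.card_fin])
  have hμ : ((maximalIdeal O).spanFinrank : WithBot ℕ∞) = d := by
    rw [IsRegularLocalRing.spanFinrank_maximalIdeal, htdim]
  have hμ' : (maximalIdeal O).spanFinrank = d := by exact_mod_cast hμ
  have hd_le : d ≤ T.card := by
    have h1 := Submodule.spanFinrank_span_le_ncard_of_finite (R := O) (T.finite_toSet)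
    rw [Set.ncard_coe_finset] at h1
    have h2 : Submodule.span O (T : Set O) = maximalIdeal O := by
      rw [hT, ← htspan]
    rw [h2, hμ'] at h1
    exact h1
  have hTcard : T.card = d := le_antisymm hTcard_le hd_le
  have htinj : Function.Injective t := by
    have h : (Finset.univ.image t).card = (Finset.univ : Finset (Fin d)).card := by
      rw [← hT_def, hTcard, Finset.card_univ, Fintype.card_fin]
    have h' := Finset.card_image_iff.mp h
    rwa [Finset.coe_univ, Set.injOn_univ] at h'
  have hScard : S.card = r := by
    rw [hS_def, Finset.card_image_of_injective _ (htinj.comp hι), Finset.card_univ,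
      Fintype.card_fin]
  have sub : (S : Set O) ⊆ maximalIdeal O := by
    rw [hS, ← htspan]
    exact (Set.range_comp_subset_range ι t).trans Ideal.subset_span
  have hST : S ⊆ T := by
    intro x hx
    rw [hS_def, Finset.mem_image] at hx
    obtain ⟨i, -, rfl⟩ := hx
    exact Finset.mem_image_of_mem t (Finset.mem_univ (ι i))
  have hTspan : Ideal.span (T : Set O) = maximalIdeal O := by rw [hT, htspan]
  have h02 := (quotient_isRegularLocalRing_tfae O S sub).out 0 2
  have key := h02.mp ⟨T, hST, by rw [hTcard, htdim], hTspan⟩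
  rw [hS, hScard] at key
  exact key

/-- **The reduction of a regular local ring modulo part of a regular system of parameters keeps
residual non-`p`-th powers and transversal parameters.** Technical form used below: for a
surjection `O → Ō = O/I` of local rings, `ā ∈ 𝔪_Ō ↔ a ∈ 𝔪_O`, and `ā ∈ 𝔪_Ō² → a ∈ 𝔪_O² + I`.
[folklore] -/
theorem mem_sq_sup_of_mk_mem_sq {O : Type*} [CommRing O] [IsLocalRing O] (I : Ideal O)
    [IsLocalRing (O ⧸ I)] (a : O)
    (h : Ideal.Quotient.mk I a ∈ maximalIdeal (O ⧸ I) ^ 2) : a ∈ maximalIdeal O ^ 2 ⊔ I := by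
  rw [← map_maximalIdeal_of_surjective (Ideal.Quotient.mk I) Ideal.Quotient.mk_surjective,
    ← Ideal.map_pow, ← Ideal.mem_comap,
    Ideal.comap_map_of_surjective _ Ideal.Quotient.mk_surjective, ← RingHom.ker_eq_comap_bot,
    Ideal.mk_ker] at h
  exact h

/-- **Regular-type points: `C = integralClosure O L` and `C/(t_ι)` are regular, of dimensions
differing by `r`.** Let `O` be a regular local ring of characteristic `p` with fraction field `K`,
regular system of parameters `t₁, …, t_d` (`d = dim O`), `L/K` of degree `p` generated by
`y ∉ K` with `y^p = u₀ ∈ O`, and `ι : Fin r ↪ Fin d` the boundary parameters; assume `u₀` is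
WOUND (`∀ x, u₀ - x^p ∉ 𝔪`) or TRANSVERSAL to the boundary (`u₀ - x^p ∈ 𝔪`,
`u₀ - x^p ∉ 𝔪² + (t_ι)` for some `x`). Then `integralClosure O L` is a regular local ring, its
quotient by `(t_{ι 1}, …, t_{ι r})` is a regular local ring, and
`dim (integralClosure O L)/(t_ι) + r = dim integralClosure O L`. [folklore] -/
theorem stub_regularTypeSop {O K L : Type} [CommRing O] [IsRegularLocalRing O] [Field K]
    [Algebra O K] [IsFractionRing O K] [Field L] [Algebra K L] [Algebra O L] [IsScalarTower O K L]
    [FiniteDimensional K L] (p : ℕ) (hp : p.Prime) [CharP O p] [CharP L p]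
    (hdeg : Module.finrank K L = p) (u₀ : O) (y : L) (hy : y ∉ Set.range (algebraMap K L))
    (hyp : y ^ p = algebraMap O L u₀) (d : ℕ) (t : Fin d → O)
    (htspan : Ideal.span (Set.range t) = IsLocalRing.maximalIdeal O)
    (htdim : ringKrullDim O = (d : WithBot ℕ∞)) (r : ℕ) (ι : Fin r → Fin d)
    (hι : Function.Injective ι)
    (hu : (∀ x : O, u₀ - x ^ p ∉ IsLocalRing.maximalIdeal O) ∨
      (∃ x : O, u₀ - x ^ p ∈ IsLocalRing.maximalIdeal O ∧
        u₀ - x ^ p ∉ IsLocalRing.maximalIdeal O ^ 2 ⊔ Ideal.span (Set.range (t ∘ ι)))) :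
    IsRegularLocalRing (integralClosure O L) ∧
      IsRegularLocalRing (integralClosure O L ⧸
        (Ideal.span (Set.range (t ∘ ι))).map (algebraMap O (integralClosure O L))) ∧
      ringKrullDim (integralClosure O L ⧸
          (Ideal.span (Set.range (t ∘ ι))).map (algebraMap O (integralClosure O L))) +
        (r : WithBot ℕ∞) = ringKrullDim (integralClosure O L) := by
  classical
  haveI : Fact p.Prime := ⟨hp⟩
  haveI : IsDomain O := isDomain_of_isRegularLocalRing O
  set I : Ideal O := Ideal.span (Set.range (t ∘ ι)) with hI_def
  set f : O[X] := X ^ p - C u₀ with hf_def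
  have hf : f.Monic := monic_X_pow_sub_C u₀ hp.ne_zero
  -- Step 1: `Ō = O/(t_ι)` is regular of dimension `d - r`
  obtain ⟨hOreg, hOdim⟩ := isRegularLocalRing_quotient_span_range_comp d t htspan htdim r ι hι
  rw [← hI_def] at hOreg hOdim
  haveI := hOreg
  haveI : IsLocalHom (Ideal.Quotient.mk I) :=
    IsLocalHom.of_surjective _ Ideal.Quotient.mk_surjective
  haveI : CharP (O ⧸ I) p := CharP.of_ringHom_of_ne_zero (Ideal.Quotient.mk I) p hp.ne_zero
  have hmem : ∀ a : O, Ideal.Quotient.mk I a ∈ maximalIdeal (O ⧸ I) ↔ a ∈ maximalIdeal O :=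
    fun a => by rw [← Ideal.mem_comap, maximalIdeal_comap]
  -- Step 2: `B = O[T]/(T^p - u₀)` is regular
  have hBreg : IsRegularLocalRing (AdjoinRoot f) := by
    rcases hu with hw | ⟨x, hx1, hx2⟩
    · exact WoundExit.isRegularLocalRing_adjoinRoot_of_wound p hp u₀ hw
    · exact TransversalExit.isRegularLocalRing_adjoinRoot_of_transversal p u₀ x hx1
        fun h => hx2 (Ideal.mem_sup_left h)
  -- Step 3: `B̄ = Ō[T]/(T^p - ū₀)` is regular
  have hmapf : f.map (Ideal.Quotient.mk I) = X ^ p - C (Ideal.Quotient.mk I u₀) := by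
    rw [hf_def, Polynomial.map_sub, Polynomial.map_pow, map_X, map_C]
  have hB'reg : IsRegularLocalRing (AdjoinRoot (f.map (Ideal.Quotient.mk I))) := by
    rw [hmapf]
    rcases hu with hw | ⟨x, hx1, hx2⟩
    · refine WoundExit.isRegularLocalRing_adjoinRoot_of_wound p hp _ fun c hc => ?_
      obtain ⟨c, rfl⟩ := Ideal.Quotient.mk_surjective c
      rw [← map_pow, ← map_sub, hmem] at hc
      exact hw c hc
    · refine TransversalExit.isRegularLocalRing_adjoinRoot_of_transversal p _
        (Ideal.Quotient.mk I x) ?_ ?_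
      · rw [← map_pow, ← map_sub, hmem]
        exact hx1
      · rw [← map_pow, ← map_sub]
        exact fun h => hx2 (mem_sq_sup_of_mk_mem_sq I _ h)
  -- Step 4: `B/(t_ι)B ≃ B̄`
  let e₂ : (AdjoinRoot f ⧸ I.map (AdjoinRoot.of f)) ≃+* AdjoinRoot (f.map (Ideal.Quotient.mk I)) :=
    (AdjoinRoot.quotEquivQuotMap f I).toRingEquiv
  -- Step 5: `B ≃ C = integralClosure O L`
  haveI := hBreg
  obtain ⟨φ, -, -, hIC⟩ := isIntegralClosure_adjoinRoot_of_isRegularLocalRing hp hdeg u₀ y hy hyp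
  letI algAL : Algebra (AdjoinRoot f) L := φ.toRingHom.toAlgebra
  haveI : IsScalarTower O (AdjoinRoot f) L :=
    IsScalarTower.of_algebraMap_eq fun x => (φ.commutes x).symm
  haveI := hIC
  let e₁ : AdjoinRoot f ≃ₐ[O] integralClosure O L :=
    IsIntegralClosure.equiv O (AdjoinRoot f) L (integralClosure O L)
  -- Step 6: `B/(t_ι)B ≃ C/(t_ι)C`
  have hcomp : (e₁.toRingEquiv : AdjoinRoot f →+* integralClosure O L).comp (AdjoinRoot.of f) =
      algebraMap O (integralClosure O L) := by
    refine RingHom.ext fun x => ?_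
    rw [RingHom.comp_apply, ← AdjoinRoot.algebraMap_eq]
    exact e₁.commutes x
  have hJ : I.map (algebraMap O (integralClosure O L)) =
      (I.map (AdjoinRoot.of f)).map (e₁.toRingEquiv : AdjoinRoot f →+* integralClosure O L) := by
    rw [Ideal.map_map, hcomp]
  let e₃ : (AdjoinRoot f ⧸ I.map (AdjoinRoot.of f)) ≃+*
      (integralClosure O L ⧸ I.map (algebraMap O (integralClosure O L))) :=
    Ideal.quotientEquiv _ _ e₁.toRingEquiv hJ
  -- Step 7: dimensions of the finite free extensions `O ⊆ B`, `Ō ⊆ B̄`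
  haveI : Module.Free O (AdjoinRoot f) := hf.free_adjoinRoot
  haveI : Module.Finite O (AdjoinRoot f) := hf.finite_adjoinRoot
  haveI : Algebra.IsIntegral O (AdjoinRoot f) := inferInstance
  have hinj : Function.Injective (algebraMap O (AdjoinRoot f)) :=
    FaithfulSMul.algebraMap_injective O _
  have hdimB : ringKrullDim (AdjoinRoot f) = ringKrullDim O :=
    (Literature.RingTheory.KrullDimension.ringKrullDim_eq_of_isIntegral hinj).symm
  haveI := hB'reg
  haveI : Module.Free (O ⧸ I) (AdjoinRoot (f.map (Ideal.Quotient.mk I))) :=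
    (hf.map _).free_adjoinRoot
  haveI : Module.Finite (O ⧸ I) (AdjoinRoot (f.map (Ideal.Quotient.mk I))) :=
    (hf.map _).finite_adjoinRoot
  haveI : Algebra.IsIntegral (O ⧸ I) (AdjoinRoot (f.map (Ideal.Quotient.mk I))) := inferInstance
  have hinj' : Function.Injective (algebraMap (O ⧸ I) (AdjoinRoot (f.map (Ideal.Quotient.mk I)))) :=
    FaithfulSMul.algebraMap_injective (O ⧸ I) _
  have hdimB' : ringKrullDim (AdjoinRoot (f.map (Ideal.Quotient.mk I))) = ringKrullDim (O ⧸ I) :=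
    (Literature.RingTheory.KrullDimension.ringKrullDim_eq_of_isIntegral hinj').symm
  refine ⟨IsRegularLocalRing.of_ringEquiv e₁.toRingEquiv, ?_, ?_⟩
  · haveI := IsRegularLocalRing.of_ringEquiv e₂.symm
    exact IsRegularLocalRing.of_ringEquiv e₃
  · rw [← ringKrullDim_eq_of_ringEquiv e₃, ringKrullDim_eq_of_ringEquiv e₂,
      ← ringKrullDim_eq_of_ringEquiv e₁.toRingEquiv, hdimB', hdimB, hOdim]

end Summit.ResolutionOfSingularities.ResolutionOfSingularities.Theorems.RadicialJung.CleanModelsSuffice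

end
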